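import Summits.Ventures.CertifiedManyBodySolver.Observables.PhaseSeparationExclusionBox
import Literature.MathematicalPhysics.QuantumLattice.HubbardTTPrimePhaseCoexistenceExclusionPeriodic
import HarnessLib
import HarnessLib.Audit

/-!
# Ventures/CertifiedManyBodySolver — Observables/PhaseSeparationExclusionPeriodicPhasesCells.lean (PERIODIC-PHASES versions of the GENERIC `(t′, U)`-CELL phase-separation exclusion laws of `PhaseSeparationExclusionBox`: the separated components may be ANY superlattice-periodic states — stripes, Néel antiferromagnets, density waves)

HONEST FRAMING: laws only (no certificate, no CERTIFIED row, no number); not a superconductivity statement. CLASS = DERIVED: each theorem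
is hubbard-downfold-unc-2's generic cell law of the same stem (`ps_not_groundState_mix_on_cell_of_fns`, `…_of_columns`,
`ps_not_groundState_mix_above_column`, `ps_margin_le_meanEnergy_mix_on_cell_of_fns`; `Observables/PhaseSeparationExclusionBox`, p648351)
with the translation-invariant components replaced by `q`-PERIODIC ones (`InfVolFermionState.IsPeriodic q`), their densities by CELL
FILLINGS `ω.cellFilling q` and the mixture's mean energy by its CELL ENERGY `cellEnergy` (energy per site), via the PROVED transfer law
`InfVolFermionState.IsPeriodic.energyDensityTT'_lt_cellEnergy_mix_of_forall_isTranslationInvariant_thresholds` and §1 of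
`Literature/…/HubbardTTPrimePhaseCoexistenceExclusionPeriodic` (hubbard-box-p3 g24, p657167). Seat hubbard-box-p3 g24
(`prover-hubbard-box-p3-g24-0`); companions `PhaseSeparationExclusionPeriodicPhases` (p657716, `t′ = 0` instances) and
`PhaseSeparationExclusionPeriodicPhasesLa214` (p657977, the La214 box instances).

THE POINT. Material-box competing-order words are filed per `(t′, U)` cell from function-valued caps/floors (`_of_fns`), from two floor
columns + an affine cap (`_of_columns`), or above a column by `U`-monotonicity (`_above_column`). With this file every future cell word is
born with its periodic-phases reading: same data hypotheses, conclusion **for all `q`-periodic `ω₁, ω₂` with cell fillings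
`0 < ρ̄(ω₁) ≤ n₁`, `n₂ ≤ ρ̄(ω₂) < 2` and all `0 < λ < 1`, at every `(s, U)` of the cell, `e(t, s, U, ρ̄(λω₁ + (1−λ)ω₂)) < Ē(λω₁ + (1−λ)ω₂)`**
— the phase-separated state of ANY two superlattice-ordered phases across `[n₁, n₂]` is not a ground state anywhere on the cell; and the
ENERGY GAP form: components of cell fillings exactly `n₁, n₂` ⇒ the separated state lies at least `a F₁ + b F₂ − C` per site above `e` at its
filling. Two different period lattices: pass to the product cell first (`IsPeriodic.isPeriodic_prodPeriod_left/right`).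

WHAT THIS IS NOT: a certificate; a statement about `T > 0`, aperiodic components, or periodic phases of filling inside `(n₁, n₂)`.
[cite: Israel1979, Thm. I.2.4] [cite: EmeryKivelsonLin1990, pp. 475–476] [cite: BratteliRobinsonI1987, §4.3.1] [cite: Ruelle1969, §3.3]
-/

noncomputable section

namespace Summit.Ventures.CertifiedManyBodySolver.Observables

open Literature.MathematicalPhysics.QuantumLattice Literature.MathematicalPhysics.QuantumLattice.ThermodynamicLimit
open Literature.MathematicalPhysics.QuantumLattice.InfVolFermionState Set
open scoped ComplexOrder

/-- **Cell law, function-valued data, PERIODIC components.** Cell `s ∈ [s₁,s₂]`, `U ∈ [U₁,U₂]` (`U₁ ≥ 0`), thresholds `n₁ < n₂`,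
weights `a, b ≥ 0`, `a + b = 1`; a cap function `C` at the mean density `a n₁ + b n₂`, floor functions `F₁`, `F₂` at `n₁`, `n₂`, positive
margin `C < a F₁ + b F₂` on the cell. Then at every `(s, U)` of the cell, for all `q`-periodic `ω₁, ω₂` (stripes, Néel / density-wave states,
any superlattice order with a common period lattice) with cell fillings `0 < ρ̄(ω₁) ≤ n₁`, `n₂ ≤ ρ̄(ω₂) < 2` and all `0 < λ < 1`:
`e(t,s,U, ρ̄(λω₁+(1−λ)ω₂)) < Ē(λω₁+(1−λ)ω₂)` — the phase-separated state is not a ground state. Periodic twin of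
`ps_not_groundState_mix_on_cell_of_fns`. [cite: Israel1979, Thm. I.2.4] [cite: EmeryKivelsonLin1990, pp. 475–476] [cite: BratteliRobinsonI1987, §4.3.1] -/
theorem ps_periodic_not_groundState_mix_on_cell_of_fns (t : ℝ) {s₁ s₂ U₁ U₂ n₁ n₂ a b : ℝ} (hU₁ : 0 ≤ U₁) (hn : n₁ < n₂)
    (ha : 0 ≤ a) (hb : 0 ≤ b) (hab : a + b = 1) {C F₁ F₂ : ℝ → ℝ → ℝ}
    (hC : ∀ s ∈ Icc s₁ s₂, ∀ U ∈ Icc U₁ U₂, energyDensityTT' t s U (a * n₁ + b * n₂) ≤ C s U)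
    (hF₁ : ∀ s ∈ Icc s₁ s₂, ∀ U ∈ Icc U₁ U₂, F₁ s U ≤ energyDensityTT' t s U n₁)
    (hF₂ : ∀ s ∈ Icc s₁ s₂, ∀ U ∈ Icc U₁ U₂, F₂ s U ≤ energyDensityTT' t s U n₂)
    (hpos : ∀ s ∈ Icc s₁ s₂, ∀ U ∈ Icc U₁ U₂, C s U < a * F₁ s U + b * F₂ s U)
    {s : ℝ} (hs : s ∈ Icc s₁ s₂) {U : ℝ} (hU : U ∈ Icc U₁ U₂)
    {q : Fin 2 → ℕ} {ω₁ ω₂ : InfVolFermionState 2} (h₁ : ω₁.IsPeriodic q) (h₂ : ω₂.IsPeriodic q)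
    (hρ₁ : 0 < ω₁.cellFilling q) (hρ₁' : ω₁.cellFilling q ≤ n₁) (hρ₂ : n₂ ≤ ω₂.cellFilling q) (hρ₂' : ω₂.cellFilling q < 2)
    {lam : ℝ} (hl0 : 0 < lam) (hl1 : lam < 1) :
    energyDensityTT' t s U ((mix lam hl0.le hl1.le ω₁ ω₂).cellFilling q) <
      (mix lam hl0.le hl1.le ω₁ ω₂).cellEnergy (fun _ : Cell q => hubbardTTPrimeFermionInteraction t s U) 1 :=
  IsPeriodic.energyDensityTT'_lt_cellEnergy_mix_of_forall_isTranslationInvariant_thresholds t s U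
    (fun _ _ k₁ k₂ a' b' c' e' _ hl0' hl1' =>
      ps_not_groundState_mix_on_cell_of_fns t hU₁ hn ha hb hab hC hF₁ hF₂ hpos hs hU k₁ k₂ a' b' c' e' hl0' hl1')
    h₁ h₂ hρ₁ hρ₁' hρ₂ hρ₂' hl0 hl1

/-- **ENERGY GAP of the separated state of two PERIODIC phases on a cell.** Same cell data (no positivity needed): at every `(s, U)` of
the cell, for `q`-periodic `ω₁, ω₂` of cell fillings EXACTLY `n₁, n₂` (`0 < n₁`, `n₂ < 2`) the mixture with weight `a` on `ω₁` (cell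
filling `a n₁ + (1−a) n₂`) has cell energy at least `a F₁ + (1−a) F₂ − C` (evaluated at `(s, U)`) above `e` at its filling. Periodic twin of
`ps_margin_le_meanEnergy_mix_on_cell_of_fns`. [cite: Israel1979, Thm. I.2.4] [cite: EmeryKivelsonLin1990, pp. 475–476] [cite: BratteliRobinsonI1987, §4.3.1] -/
theorem ps_periodic_margin_le_cellEnergy_mix_on_cell_of_fns (t : ℝ) {s₁ s₂ U₁ U₂ n₁ n₂ a : ℝ} (hU₁ : 0 ≤ U₁)
    (hn₁ : 0 < n₁) (hn₂ : n₂ < 2) (hn : n₁ < n₂) (ha0 : 0 ≤ a) (ha1 : a ≤ 1) {C F₁ F₂ : ℝ → ℝ → ℝ}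
    (hC : ∀ s ∈ Icc s₁ s₂, ∀ U ∈ Icc U₁ U₂, energyDensityTT' t s U (a * n₁ + (1 - a) * n₂) ≤ C s U)
    (hF₁ : ∀ s ∈ Icc s₁ s₂, ∀ U ∈ Icc U₁ U₂, F₁ s U ≤ energyDensityTT' t s U n₁)
    (hF₂ : ∀ s ∈ Icc s₁ s₂, ∀ U ∈ Icc U₁ U₂, F₂ s U ≤ energyDensityTT' t s U n₂)
    {s : ℝ} (hs : s ∈ Icc s₁ s₂) {U : ℝ} (hU : U ∈ Icc U₁ U₂)
    {q : Fin 2 → ℕ} {ω₁ ω₂ : InfVolFermionState 2} (h₁ : ω₁.IsPeriodic q) (h₂ : ω₂.IsPeriodic q)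
    (hρ₁ : ω₁.cellFilling q = n₁) (hρ₂ : ω₂.cellFilling q = n₂) :
    energyDensityTT' t s U ((mix a ha0 ha1 ω₁ ω₂).cellFilling q) + (a * F₁ s U + (1 - a) * F₂ s U - C s U) ≤
      (mix a ha0 ha1 ω₁ ω₂).cellEnergy (fun _ : Cell q => hubbardTTPrimeFermionInteraction t s U) 1 := by
  rw [cellFilling_mix_eq_density_mix_cellAverage, cellEnergy_mix_eq_meanEnergy_mix_cellAverage]
  rw [ω₁.cellFilling_eq_density_cellAverage] at hρ₁
  rw [ω₂.cellFilling_eq_density_cellAverage] at hρ₂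
  exact ps_margin_le_meanEnergy_mix_on_cell_of_fns t hU₁ hn₁ hn₂ hn ha0 ha1 hC hF₁ hF₂ hs hU
    h₁.isTranslationInvariant_cellAverage h₂.isTranslationInvariant_cellAverage hρ₁ hρ₂

/-- **Cell law, two floor columns + affine cap, PERIODIC components.** Cell `[s₁,s₂] × [U₁,U₂]` (`0 ≤ U₁ < U₂`), thresholds
`0 ≤ n₁ < n₂ < 2`, weights `a + b = 1`; cap `e(t,s,U, a n₁ + b n₂) ≤ c₀ + c₁ U` on the cell; floor columns `L₁(s) ≤ e(t,s,U₁,n₂)`,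
`L₂(s) ≤ e(t,s,U₂,n₂)` and a floor `F₁(s) ≤ e(t,s,U,n₁)` on the cell; positive margins at the two columns. Then at every `(s, U)` of the
cell the `(ρ̄₁ ≤ n₁ | ρ̄₂ ≥ n₂)` separation into ANY two `q`-periodic phases is excluded (energy per site strictly above `e` at the cell
filling). Periodic twin of `ps_not_groundState_mix_on_cell_of_columns`. [cite: Israel1979, Thm. I.2.4] [cite: EmeryKivelsonLin1990, pp. 475–476] [cite: BratteliRobinsonI1987, §4.3.1] -/
theorem ps_periodic_not_groundState_mix_on_cell_of_columns (t : ℝ) {s₁ s₂ U₁ U₂ n₁ n₂ a b c₀ c₁ : ℝ} (hU₁ : 0 ≤ U₁)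
    (h12 : U₁ < U₂) (hn₁ : 0 ≤ n₁) (hn : n₁ < n₂) (hn₂ : n₂ < 2) (ha : 0 ≤ a) (hb : 0 ≤ b) (hab : a + b = 1)
    {L₁ L₂ F₁ : ℝ → ℝ}
    (hC : ∀ s ∈ Icc s₁ s₂, ∀ U ∈ Icc U₁ U₂, energyDensityTT' t s U (a * n₁ + b * n₂) ≤ c₀ + c₁ * U)
    (hL₁ : ∀ s ∈ Icc s₁ s₂, L₁ s ≤ energyDensityTT' t s U₁ n₂) (hL₂ : ∀ s ∈ Icc s₁ s₂, L₂ s ≤ energyDensityTT' t s U₂ n₂)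
    (hF₁ : ∀ s ∈ Icc s₁ s₂, ∀ U ∈ Icc U₁ U₂, F₁ s ≤ energyDensityTT' t s U n₁)
    (hm₁ : ∀ s ∈ Icc s₁ s₂, c₀ + c₁ * U₁ < a * F₁ s + b * L₁ s)
    (hm₂ : ∀ s ∈ Icc s₁ s₂, c₀ + c₁ * U₂ < a * F₁ s + b * L₂ s)
    {s : ℝ} (hs : s ∈ Icc s₁ s₂) {U : ℝ} (hU : U ∈ Icc U₁ U₂)
    {q : Fin 2 → ℕ} {ω₁ ω₂ : InfVolFermionState 2} (h₁ : ω₁.IsPeriodic q) (h₂ : ω₂.IsPeriodic q)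
    (hρ₁ : 0 < ω₁.cellFilling q) (hρ₁' : ω₁.cellFilling q ≤ n₁) (hρ₂ : n₂ ≤ ω₂.cellFilling q) (hρ₂' : ω₂.cellFilling q < 2)
    {lam : ℝ} (hl0 : 0 < lam) (hl1 : lam < 1) :
    energyDensityTT' t s U ((mix lam hl0.le hl1.le ω₁ ω₂).cellFilling q) <
      (mix lam hl0.le hl1.le ω₁ ω₂).cellEnergy (fun _ : Cell q => hubbardTTPrimeFermionInteraction t s U) 1 :=
  IsPeriodic.energyDensityTT'_lt_cellEnergy_mix_of_forall_isTranslationInvariant_thresholds t s U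
    (fun _ _ k₁ k₂ a' b' c' e' _ hl0' hl1' =>
      ps_not_groundState_mix_on_cell_of_columns t hU₁ h12 hn₁ hn hn₂ ha hb hab hC hL₁ hL₂ hF₁ hm₁ hm₂ hs hU k₁ k₂ a' b' c' e'
        hl0' hl1')
    h₁ h₂ hρ₁ hρ₁' hρ₂ hρ₂' hl0 hl1

/-- **Above a column, PERIODIC components.** Cell `[s₁,s₂] × [U₂,U₃]` (`U₂ ≥ 0`), cap `e(t,s,U, a n₁ + b n₂) ≤ c₀ + c₁ U` with `c₁ ≥ 0`,
one floor column `L(s) ≤ e(t,s,U₂,n₂)` (carried up in `U` by monotonicity), a floor `F₁(s) ≤ e(t,s,U,n₁)` on the cell, positive margin at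
the far end `U₃`. Then at every `(s, U)` of the cell the `(ρ̄₁ ≤ n₁ | ρ̄₂ ≥ n₂)` separation into ANY two `q`-periodic phases is excluded.
Periodic twin of `ps_not_groundState_mix_above_column`. [cite: Israel1979, Thm. I.2.4] [cite: EmeryKivelsonLin1990, pp. 475–476] [cite: BratteliRobinsonI1987, §4.3.1] -/
theorem ps_periodic_not_groundState_mix_above_column (t : ℝ) {s₁ s₂ U₂ U₃ n₁ n₂ a b c₀ c₁ : ℝ} (hU₂ : 0 ≤ U₂)
    (hc₁ : 0 ≤ c₁) (hn₁ : 0 ≤ n₁) (hn : n₁ < n₂) (hn₂ : n₂ < 2) (ha : 0 ≤ a) (hb : 0 ≤ b) (hab : a + b = 1)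
    {L F₁ : ℝ → ℝ}
    (hC : ∀ s ∈ Icc s₁ s₂, ∀ U ∈ Icc U₂ U₃, energyDensityTT' t s U (a * n₁ + b * n₂) ≤ c₀ + c₁ * U)
    (hL : ∀ s ∈ Icc s₁ s₂, L s ≤ energyDensityTT' t s U₂ n₂)
    (hF₁ : ∀ s ∈ Icc s₁ s₂, ∀ U ∈ Icc U₂ U₃, F₁ s ≤ energyDensityTT' t s U n₁)
    (hm : ∀ s ∈ Icc s₁ s₂, c₀ + c₁ * U₃ < a * F₁ s + b * L s)
    {s : ℝ} (hs : s ∈ Icc s₁ s₂) {U : ℝ} (hU : U ∈ Icc U₂ U₃)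
    {q : Fin 2 → ℕ} {ω₁ ω₂ : InfVolFermionState 2} (h₁ : ω₁.IsPeriodic q) (h₂ : ω₂.IsPeriodic q)
    (hρ₁ : 0 < ω₁.cellFilling q) (hρ₁' : ω₁.cellFilling q ≤ n₁) (hρ₂ : n₂ ≤ ω₂.cellFilling q) (hρ₂' : ω₂.cellFilling q < 2)
    {lam : ℝ} (hl0 : 0 < lam) (hl1 : lam < 1) :
    energyDensityTT' t s U ((mix lam hl0.le hl1.le ω₁ ω₂).cellFilling q) <
      (mix lam hl0.le hl1.le ω₁ ω₂).cellEnergy (fun _ : Cell q => hubbardTTPrimeFermionInteraction t s U) 1 :=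
  IsPeriodic.energyDensityTT'_lt_cellEnergy_mix_of_forall_isTranslationInvariant_thresholds t s U
    (fun _ _ k₁ k₂ a' b' c' e' _ hl0' hl1' =>
      ps_not_groundState_mix_above_column t hU₂ hc₁ hn₁ hn hn₂ ha hb hab hC hL hF₁ hm hs hU k₁ k₂ a' b' c' e' hl0' hl1')
    h₁ h₂ hρ₁ hρ₁' hρ₂ hρ₂' hl0 hl1

end Summit.Ventures.CertifiedManyBodySolver.Observables

end
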